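import Summits.Langlands.Langlands.Theses.PolarisationCarving

/-!
# PolarisationCarving — glue of the layer-1 split (k = 3) of `NonTRCMTypeAutomorphy`

Closes the glue item stmt-Langlands-33476
`PolarisationCarving.NonTRCMTypeAutomorphy_of_split :
  InducedRegularTypeAutomorphy → AbelianSurfaceTypeAutomorphy → DeepNonTRCMTypeAutomorphy → NonTRCMTypeAutomorphy`
(route-Langlands-PolarisationCarving rev 5; lens-6-g11 node `InducedPolarisationCarving`, crit-1 g4 row 129).

Pure logic: two excluded middles — on the inlined induced-regular sandwich (IRP) and on the abelian-surface sandwich (IAS) —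
written with `by_contra` so that NO dial is restated (the negated dials are the `fun h => hno (…)` terms, typed by the
children's binders).  Plus the exactness statement NTC ↔ IRT ∧ AST ∧ DNT.  No definitions, no new mathematics.
-/

set_option linter.dupNamespace false -- project-wide option; `Summit.Langlands.Langlands` is the mandated namespace

namespace Summit.Langlands.Langlands.Theorems

open Summit.Langlands.Langlands.Theses

/-- The split glue IRT → AST → DNT → NTC. -/
theorem NonTRCMTypeAutomorphy_of_split_proof : PolarisationCarving.NonTRCMTypeAutomorphy_of_split := by
  intro hI hA hD K _ _ n hcpt hn ℓ _ ι ρ hirr hgeo htw hntc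
  by_contra hno
  refine hno (hD K n hcpt hn ℓ ι ρ hirr hgeo htw ⟨hntc, fun hi => hno ?g1, fun ha => hno ?g2⟩)
  case g1 => exact hI K n hcpt hn ℓ ι ρ hirr hgeo htw ⟨hntc, hi⟩
  case g2 =>
    exact hA K n hcpt hn ℓ ι ρ hirr hgeo htw
      ⟨hntc, fun hi => hno (hI K n hcpt hn ℓ ι ρ hirr hgeo htw ⟨hntc, hi⟩), ha⟩

/-- … and conversely: NTC ⟺ IRT ∧ AST ∧ DNT (the split is exact; each cell is NTC restricted to a sub-box). -/
theorem NonTRCMTypeAutomorphy_split_exact :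
    PolarisationCarving.NonTRCMTypeAutomorphy ↔
      (PolarisationCarving.InducedRegularTypeAutomorphy ∧ PolarisationCarving.AbelianSurfaceTypeAutomorphy ∧
        PolarisationCarving.DeepNonTRCMTypeAutomorphy) := by
  refine ⟨fun h => ⟨?_, ?_, ?_⟩, fun h => NonTRCMTypeAutomorphy_of_split_proof h.1 h.2.1 h.2.2⟩
  · intro K _ _ n hcpt hn ℓ _ ι ρ hirr hgeo htw hc
    exact h K n hcpt hn ℓ ι ρ hirr hgeo htw hc.1
  · intro K _ _ n hcpt hn ℓ _ ι ρ hirr hgeo htw hc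
    exact h K n hcpt hn ℓ ι ρ hirr hgeo htw hc.1
  · intro K _ _ n hcpt hn ℓ _ ι ρ hirr hgeo htw hc
    exact h K n hcpt hn ℓ ι ρ hirr hgeo htw hc.1

end Summit.Langlands.Langlands.Theorems
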